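import Summits.PneNP.PneNP.Theses.PermanentDescent
import Summits.PneNP.PneNP.Theorems.PermanentDescentCollapseMakesPermanentEasyDefs
import Summits.PneNP.PneNP.Theorems.PermanentDescentCollapseMakesPermanentEasyStubLaplace
import Summits.PneNP.PneNP.Theorems.PermanentDescentCollapseMakesPermanentEasyStubSound
import Summits.PneNP.PneNP.Theorems.PermanentDescentCollapseMakesPermanentEasyStubComplete
import Summits.PneNP.PneNP.Theorems.PermanentDescentCollapseMakesPermanentEasyStubAnsValFP
import Summits.PneNP.PneNP.Theorems.PermanentDescentCollapseMakesPermanentEasyStubCheckFP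
import Literature.Computability.Complexity.SearchToDecision
import Literature.Computability.Complexity.CircuitEval
import Literature.Computability.Complexity.LundEtAl1992Proofs
import Summits.PneNP.PneNP.Theorems.UniformStreamUniformMagnificationVariants160473
import Literature.Computability.AlgebraicComplexity.PermanentBitsPPoly

/-!
# Route PermanentDescent — `UniformizationUnderCollapse` (stmt-PneNP-16145): algorithm design in Algorithmica

`NP ⊆ P → PermBits ∈ P/poly → PermBits ∈ P` — the UNIFORM half of the crux `CollapseMakesPermanentEasy`
(stmt-PneNP-16142, line `birth`): under the collapse, small advice for the permanent's bit-graph can be FOUND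
and CERTIFIED. Proof (Karp–Lipton-type search-to-decision, certified by the permanent's Laplace
self-reduction; all machine-level work in the tree's `CodeFP` calculus):

1. `P/poly = P` with polynomial advice (`PPoly_eq_polyAdvice_P_holds`): a `P`-predicate `χ` and advice `a`
   with `x ∈ PermBits ↔ χ ⟨x, a |x|⟩`; by injectivity of the query format, `χ` with the true advice answers
   every query `⟨s, bin i⟩`, `|s| = m²`, by bit `i` of `permWord m s` (`boolPair_mem_PermBits_iff`).
2. Certificate: a TABLE of candidate advice strings is GOOD for the query `x` (`|x.1| = n²`) when the values
   it induces pass the Laplace row-expansion test at every square word of length `≤ n²`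
   (`GoodT`, objects in `…CollapseMakesPermanentEasyDefs.lean`). Good tables answer true bits
   (`stub_soundT`), the true table is good (`stub_completeT`), both through the Laplace identity in the word
   encoding (`stub_laplaceWord`); the test matrix is polynomial time (`stub_ansValFP`, `stub_checkFP`), so the
   relation `relR` of pairs `⟨x, table code⟩` is a `polyForall` of a `P` language, i.e. in `coNP ⊆ P` under
   `NP ⊆ P` (`relR_mem_P`, with `polyForall P ⊆ P` reused from
   `…Cruxes.UniformMagnification.Birth.SearchStream.polyForall_P_subset_P`).
3. Search: `exists_searchFn_of_NP_subset_P` (Arora–Barak Thm. 2.18 under `NP ⊆ P`) returns `g ∈ FP` finding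
   a good table whenever one of polynomial length exists — and the true table has polynomial length
   (`length_encList_tableOf_le`).
4. Decider: parse `x = ⟨s, bin i⟩` (`wfB`), bound `i ≤ |s|` (else bit `i` of `perm ≤ n! < 2^{n²+1}` is `0`,
   `permWord_lt_two_pow_aux`), read the answer off the found table (`decideB`, in `P` by `decideB_codeFP`);
   correctness by soundness of the found good table.

Sources: R. M. Karp, R. J. Lipton, STOC 1980 (Thm. 6.1); S. Arora, B. Barak, *Computational Complexity*
(2009), Thm. 2.18, Thm. 5.4, Thm. 6.18; H. Minc, *Permanents* (1978), §1.2.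
-/

set_option linter.dupNamespace false -- `Summit.PneNP.PneNP.…`: summit = sub-problem name (D-0017 single-conjunct layout)

namespace Summit.PneNP.PneNP.Theorems.PermCert

open _root_.Computability Polynomial
open Literature.Computability.Complexity Literature.Computability.Complexity.Brick
  Literature.Computability.Complexity.CodeFP

/-- Membership of a pair query in `PermBits`: for `|s| = m²`, `⟨s, bin i⟩ ∈ PermBits ↔ bit i of
`permWord m s` is `1` (injectivity of `boolPair` and `encodeNat`). [folklore] -/
theorem boolPair_mem_PermBits_iff {m : ℕ} {s : List Bool} (hs : s.length = m * m) (i : ℕ) :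
    boolPair s (encodeNat i) ∈ PermBits ↔ (permWord m s).testBit i = true := by
  constructor
  · rintro ⟨n, s', i', hs', heq, hbit⟩
    have hinj := boolPair_injective (a₁ := (s, encodeNat i)) (a₂ := (s', encodeNat i')) heq
    simp only [Prod.mk.injEq] at hinj
    obtain ⟨rfl, hi⟩ := hinj
    have hi' : i = i' := by
      have := congrArg bitsToNat hi
      simpa using this
    subst hi'
    have hnm : n = m := by
      have h2 : n * n = m * m := by rw [← hs', hs]
      exact Nat.mul_self_inj.1 h2
    subst hnm
    exact hbit
  · intro h
    exact ⟨m, s, i, hs, rfl, h⟩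

/-- Membership in `PermBits` through the parse: `x ∈ PermBits` iff `x` is well formed (`wfB`) and bit
`bitsToNat x.2` of the permanent of `x.1` (side `√|x.1|`) is `1`. [folklore] -/
theorem mem_PermBits_iff_wfB (x : List Bool) :
    x ∈ PermBits ↔ wfB x = true ∧
      (permWord (Nat.sqrt (fstF x).length) (fstF x)).testBit (bitsToNat (sndF x)) = true := by
  constructor
  · rintro ⟨n, s, i, hs, rfl, hbit⟩
    refine ⟨?_, ?_⟩
    · simp only [wfB, fstF_boolPair, sndF_boolPair, bitsToNat_encodeNat, hs, Nat.sqrt_eq,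
        and_self, decide_true]
    · rw [fstF_boolPair, sndF_boolPair, bitsToNat_encodeNat, hs, Nat.sqrt_eq]
      exact hbit
  · rintro ⟨hwf, hbit⟩
    simp only [wfB, decide_eq_true_eq] at hwf
    obtain ⟨hx, hsq⟩ := hwf
    refine ⟨Nat.sqrt (fstF x).length, fstF x, bitsToNat (sndF x), hsq.symm, hx.symm, hbit⟩

/-- Length of the code of the true table: `|encList (advTable a n)| ≤ tabLen n · (2 p(tabLen n) + 2)` when
`|a ℓ| ≤ p ℓ`. [folklore] -/
theorem length_encList_tableOf_le (a : ℕ → List Bool) (p : Polynomial ℕ) (hp : ∀ ℓ, (a ℓ).length ≤ p.eval ℓ)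
    (n : ℕ) : (encList (advTable a n)).length ≤ tabLen n * (2 * p.eval (tabLen n) + 2) := by
  rw [length_encList]
  unfold advTable
  rw [List.map_map]
  have key : ∀ ℓ ∈ List.range (tabLen n), ((fun a : List Bool => 2 * a.length + 2) ∘ a) ℓ ≤ 2 * p.eval (tabLen n) + 2 := by
    intro ℓ hℓ
    have h1 := hp ℓ
    have h2 : p.eval ℓ ≤ p.eval (tabLen n) := TM2Iter.eval_mono p (List.mem_range.1 hℓ).le
    simp only [Function.comp_apply]
    omega
  calc (List.map ((fun a : List Bool => 2 * a.length + 2) ∘ a) (List.range (tabLen n))).sum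
      ≤ (List.map (fun _ => 2 * p.eval (tabLen n) + 2) (List.range (tabLen n))).sum :=
        List.sum_le_sum (fun ℓ hℓ => key ℓ hℓ)
    _ = tabLen n * (2 * p.eval (tabLen n) + 2) := by
        rw [List.map_const', List.sum_replicate, List.length_range, smul_eq_mul]

/-- `relR` at a pair: the decoded table is good iff the pair is in the search relation. [folklore] -/
theorem boolPair_mem_relR_iff (χ : List Bool → Bool) (x w : List Bool) :
    boolPair x w ∈ relR χ ↔ GoodT χ (decNil w) ((fstF x).length + 1) (fstF x).length := by
  constructor
  · intro h y hsq hlen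
    have hxle : (fstF x).length ≤ (boolPair x w).length := by
      have := length_fstF_sndF_le x
      rw [length_boolPair]; omega
    have := h y (hlen.trans hxle)
    simp only [fstF_boolPair, sndF_boolPair, checkB, decide_eq_true_eq] at this
    exact this ⟨hsq, hlen⟩
  · intro hG y _
    simp only [fstF_boolPair, sndF_boolPair, checkB, decide_eq_true_eq]
    exact fun hy => hG y hy.1 hy.2

variable (χ : List Bool → Bool)

/-- The matrix language of the certificate is in `P` (Stub FC composed with the total parse
`u ↦ ((u.1.1, u.1.2), u.2)`). [cite: AroraBarakCC2009, §1.3] -/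
theorem matLang_mem_P (hchk : CodeFP (pairE (pairE strE strE) strE) bitE (fun t => checkB χ t.1.1 t.1.2 t.2)) :
    matLang χ ∈ Classes.P := by
  have hparse : CodeFP strE (pairE (pairE strE strE) strE)
      (fun u => ((fstF (fstF u), sndF (fstF u)), sndF u)) :=
    of_fn (fanoutFn (fanoutFn (fstF ∘ fstF) (sndF ∘ fstF)) sndF)
      (fanoutFn_mem_FP (fanoutFn_mem_FP (comp_mem_FP fstF_mem_FP fstF_mem_FP)
        (comp_mem_FP sndF_mem_FP fstF_mem_FP)) sndF_mem_FP)
      fun u => by simp [pairE]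
  exact Literature.Computability.Complexity.LFKN.setOf_codeFP_mem_P (hchk.comp hparse)

/-- The search relation is in `P` under `NP ⊆ P` (it is a `polyForall` of the matrix language with bound
`X`). [cite: AroraBarakCC2009, Thm. 5.4] -/
theorem relR_mem_P (hNP : Nondeterministic.NP ⊆ Classes.P) (hmat : matLang χ ∈ Classes.P) :
    relR χ ∈ Classes.P := by
  refine Summit.PneNP.PneNP.Cruxes.UniformMagnification.Birth.SearchStream.polyForall_P_subset_P hNP
    (mem_polyForall_iff.2 ⟨matLang χ, hmat, X, fun z => ?_⟩)
  change (∀ y : List Bool, y.length ≤ z.length → checkB χ (fstF z) (sndF z) y = true) ↔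
    ∀ y : List Bool, y.length ≤ (X : Polynomial ℕ).eval z.length →
      checkB χ (fstF (fstF (boolPair z y))) (sndF (fstF (boolPair z y))) (sndF (boolPair z y)) = true
  simp only [fstF_boolPair, sndF_boolPair, eval_X]

/-- The decider is polynomial time on codes (Stub FA's answer map, the parse, the found table). [cite: AroraBarakCC2009, §1.3] -/
theorem decideB_codeFP {g : List Bool → List Bool} (hg : g ∈ FP)
    (hans : CodeFP (pairE (rawE strE) (pairE strE natE)) bitE (fun t => ansT χ t.1 t.2.1 t.2.2)) :
    CodeFP strE bitE (decideB χ g) := by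
  have hs : CodeFP strE strE fstF := of_fn fstF fstF_mem_FP fun _ => rfl
  have ht : CodeFP strE strE sndF := of_fn sndF sndF_mem_FP fun _ => rfl
  have hi : CodeFP strE natE (fun x => bitsToNat (sndF x)) := strVal.comp ht
  have hlen : CodeFP strE natE (fun x => (fstF x).length) := (natOfUn.comp (strLength.comp hs) :)
  have hrepair : CodeFP strE strE (fun x => boolPair (fstF x) (encodeNat (bitsToNat (sndF x)))) :=
    (transparent (eα := pairE strE natE) (eβ := strE) (g := fun p => boolPair p.1 (encodeNat p.2))
      fun _ => rfl).comp (hs.pair hi)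
  have heq : CodeFP strE bitE (fun x => decide (boolPair (fstF x) (encodeNat (bitsToNat (sndF x))) = x)) :=
    (CodeFP.eq (eα := strE) fun _ _ h => h).comp (hrepair.pair (CodeFP.id strE))
  have hsq : CodeFP strE bitE (fun x => decide (Nat.sqrt (fstF x).length * Nat.sqrt (fstF x).length = (fstF x).length)) :=
    natEq.comp ((natMul.comp ((natSqrt.comp hlen).pair (natSqrt.comp hlen))).pair hlen)
  have hwf : CodeFP strE bitE wfB :=
    (heq.and hsq).congr fun x => by simp only [wfB, Bool.decide_and]
  have hlt : CodeFP strE bitE (fun x => decide (bitsToNat (sndF x) < (fstF x).length + 1)) :=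
    natLt.comp (hi.pair (natAdd.comp (hlen.pair (const strE 1))))
  have hgC : CodeFP strE strE g := of_fn g hg fun _ => rfl
  have htab : CodeFP strE (rawE strE) (fun x => decNil (g x)) := SumcheckMA.decNilC.comp hgC
  have hansx : CodeFP strE bitE (fun x => ansT χ (decNil (g x)) (fstF x) (bitsToNat (sndF x))) :=
    hans.comp (htab.pair (hs.pair hi))
  exact (hwf.and (hlt.and hansx)).congr fun x => rfl

/-- **THE SEAM: uniformization from the stubs.** `NP ⊆ P → PermBits ∈ P/poly → PermBits ∈ P`. [folklore] -/
theorem uniformization_of_stubs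
    (hLap0 : ∀ s : List Bool, permWord 0 s = 1)
    (hLap : ∀ (k : ℕ) (s : List Bool), permWord (k + 1) s = laplaceSum k s (permWord k))
    (hsound : ∀ (χ : List Bool → Bool) (W : List (List Bool)) (B N : ℕ),
      (∀ s : List Bool, permWord 0 s = 1) →
      (∀ (k : ℕ) (s : List Bool), permWord (k + 1) s = laplaceSum k s (permWord k)) →
      GoodT χ W B N →
      ∀ (m : ℕ) (s : List Bool) (i : ℕ), s.length = m * m → m * m ≤ N → i < B →
        ansT χ W s i = (permWord m s).testBit i)
    (hcomplete : ∀ (χ : List Bool → Bool) (a : ℕ → List Bool) (n : ℕ),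
      (∀ s : List Bool, permWord 0 s = 1) →
      (∀ (k : ℕ) (s : List Bool), permWord (k + 1) s = laplaceSum k s (permWord k)) →
      (∀ (m : ℕ) (s : List Bool) (i : ℕ), s.length = m * m →
        χ (boolPair (boolPair s (encodeNat i)) (a (boolPair s (encodeNat i)).length)) = (permWord m s).testBit i) →
      GoodT χ (advTable a n) (n * n + 1) (n * n))
    (hFA : ∀ χ : List Bool → Bool, CodeFP strE bitE χ →
      CodeFP (pairE (rawE strE) (pairE strE natE)) bitE (fun t => ansT χ t.1 t.2.1 t.2.2) ∧
        CodeFP (pairE (rawE strE) (pairE unE strE)) natE (fun t => valT χ t.1 t.2.1 t.2.2))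
    (hFC : ∀ χ : List Bool → Bool,
      CodeFP (pairE (rawE strE) (pairE unE strE)) natE (fun t => valT χ t.1 t.2.1 t.2.2) →
        CodeFP (pairE (pairE strE strE) strE) bitE (fun t => checkB χ t.1.1 t.1.2 t.2)) :
    Nondeterministic.NP ⊆ Classes.P → PermBits ∈ PPoly → PermBits ∈ Classes.P := by
  intro hNP hPP
  -- (1) advice form of `P/poly`
  have ePP : PPoly = polyAdvice Classes.P := PPoly_eq_polyAdvice_P_holds
  rw [ePP] at hPP
  obtain ⟨L', hL'P, a, p, hap, hadv⟩ := hPP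
  set χ : List Bool → Bool := fun w => L'.boolIndicator w with hχdef
  have hχC : CodeFP strE bitE χ := of_fn _ (indicatorFn_mem_FP hL'P) fun _ => rfl
  -- (2) the advice answers the true bits
  have hχ : ∀ (m : ℕ) (s : List Bool) (i : ℕ), s.length = m * m →
      χ (boolPair (boolPair s (encodeNat i)) (a (boolPair s (encodeNat i)).length)) = (permWord m s).testBit i := by
    intro m s i hs
    have key := boolPair_mem_PermBits_iff hs i
    have hmem : boolPair s (encodeNat i) ∈ PermBits ↔
        χ (boolPair (boolPair s (encodeNat i)) (a (boolPair s (encodeNat i)).length)) = true := by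
      rw [hadv, hχdef]
      exact Set.mem_iff_boolIndicator _ _
    rcases h : (permWord m s).testBit i with _ | _
    · apply Bool.eq_false_iff.2
      intro hx
      have := key.1 (hmem.2 hx)
      rw [h] at this
      exact Bool.false_ne_true this
    · exact hmem.1 (key.2 h)
  -- (3) the certificate relation is in `P`
  obtain ⟨hansC, hvalC⟩ := hFA χ hχC
  have hrel : relR χ ∈ Classes.P := relR_mem_P χ hNP (matLang_mem_P χ (hFC χ hvalC))
  -- (4) search under the collapse, with the witness bound of the true table
  set Q : Polynomial ℕ := (3 * X + 4) * (2 * p.comp (3 * X + 4) + 2) with hQ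
  obtain ⟨g, hgFP, hg⟩ := exists_searchFn_of_NP_subset_P hNP hrel Q
  -- (5) the decider is in `P`
  have hdecP : ({x | decideB χ g x = true} : Language Bool) ∈ Classes.P :=
    Literature.Computability.Complexity.LFKN.setOf_codeFP_mem_P (decideB_codeFP χ hgFP hansC)
  -- (6) correctness
  suffices hEq : PermBits = {x | decideB χ g x = true} by rw [hEq]; exact hdecP
  ext x
  rw [mem_PermBits_iff_wfB]
  change _ ↔ decideB χ g x = true
  by_cases hwf : wfB x = true
  swap
  · rw [Bool.not_eq_true] at hwf
    simp [decideB, hwf]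
  simp only [hwf, true_and, decideB, Bool.true_and, Bool.and_eq_true, decide_eq_true_eq]
  -- names for the parse
  set s := fstF x with hsdef
  set i := bitsToNat (sndF x) with hidef
  set n := Nat.sqrt s.length with hndef
  have hwf' := hwf
  simp only [wfB, decide_eq_true_eq] at hwf'
  obtain ⟨hx, hsq⟩ := hwf'
  have hs : s.length = n * n := hsq.symm
  -- the found table is good: a good witness exists (completeness), so the search succeeds
  have hfound : boolPair x (g x) ∈ relR χ := by
    refine (hg x ⟨encList (advTable a n), ?_, ?_⟩).2
    · -- length of the true table's code
      have h1 := length_encList_tableOf_le a p hap n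
      have hnx : n * n ≤ x.length := by
        have := length_fstF_sndF_le x
        rw [← hsdef] at this
        omega
      have h2 : tabLen n ≤ 3 * x.length + 4 := by unfold tabLen; omega
      have h3 : p.eval (tabLen n) ≤ p.eval (3 * x.length + 4) := TM2Iter.eval_mono p h2
      have hQe : Q.eval x.length = (3 * x.length + 4) * (2 * p.eval (3 * x.length + 4) + 2) := by
        simp [hQ, eval_comp]
      rw [hQe]
      calc (encList (advTable a n)).length ≤ tabLen n * (2 * p.eval (tabLen n) + 2) := h1
        _ ≤ (3 * x.length + 4) * (2 * p.eval (3 * x.length + 4) + 2) :=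
            Nat.mul_le_mul h2 (by omega)
    · rw [boolPair_mem_relR_iff, decNil_encList, ← hsdef, hs]
      exact hcomplete χ a n hLap0 hLap hχ
  have hgood : GoodT χ (decNil (g x)) (n * n + 1) (n * n) := by
    have := (boolPair_mem_relR_iff χ x (g x)).1 hfound
    rwa [← hsdef, hs] at this
  by_cases hi : i < s.length + 1
  · simp only [hi, true_and]
    rw [hsound χ (decNil (g x)) (n * n + 1) (n * n) hLap0 hLap hgood n s i hs le_rfl (by rw [← hs]; exact hi)]
  · simp only [hi, false_and, iff_false]
    have hlt : permWord n s < 2 ^ i := by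
      refine (permWord_lt_two_pow_aux n s).trans_le (Nat.pow_le_pow_right (by norm_num) ?_)
      rw [← hs]; omega
    rw [Nat.testBit_eq_false_of_lt hlt]
    exact Bool.false_ne_true

end Summit.PneNP.PneNP.Theorems.PermCert

namespace Summit.PneNP.PneNP.Theorems

open Literature.Computability.Complexity Summit.PneNP.PneNP.Theorems.PermCert

/-- **Route item stmt-PneNP-16145 `UniformizationUnderCollapse` (support, provable-now), PROVED**:
`NP ⊆ P → PermBits ∈ P/poly → PermBits ∈ P` — the seam `uniformization_of_stubs` fed with the five landed
stubs of line `birth` (the route decl's `let PermBits := …` is the hoisted `PermCert.PermBits` verbatim).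
[cite: KarpLipton1980, Thm. 6.1] [cite: AroraBarakCC2009, Thm. 2.18] -/
theorem uniformizationUnderCollapse_proof :
    Summit.PneNP.PneNP.Theses.PermanentDescent.UniformizationUnderCollapse := by
  unfold Summit.PneNP.PneNP.Theses.PermanentDescent.UniformizationUnderCollapse
  exact uniformization_of_stubs stub_laplaceWord.1 stub_laplaceWord.2 stub_soundT stub_completeT
    stub_ansValFP stub_checkFP

end Summit.PneNP.PneNP.Theorems
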